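import Summits.Ventures.PercRepro.C025ProfileThinRowStepsA

/-!
# THE ROW `(q, q+1)` OF (Π) ON EVERY THIN(q) MATROID — part B: the parallel-pair step and the theorem (night-3 g17)
* **a parallel pair is a profile Theorem F**: `profileIneq_of_parallel` — for non-loops `x ∥ y` write `G'' = E ∖ {x, y}`; the sets
  `B ⊆ E` split by `B ∩ {x, y}` into `T`, `T ∪ {x}`, `T ∪ {y}`, `T ∪ {x, y}` (`T ⊆ G''`).  The terms `T` and `T ∪ {x, y}` are the row of
  `M' = M ＼ {y}` (the ranks of `T ∪ {x, y}` and of its complement are those of `T ∪ {x}` in `M'`); the terms `T ∪ {x}` and `T ∪ {y}`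
  coincide (ROOTED terms: `ρ(T ∪ {x}) = q + 1`, complement rank `ρ(G'' ∖ T ∪ {x})`) and their level-side counterparts are the
  rank-`(q+2)` sets through `x`.  In the contraction `N = (M ／ {x}) ＼ {y}` the rooted terms are the terms of the row `(q, q+1)` of `N`
  with a SMALLER price (part A's `price_rooted_le`: `ρ_N(T) = ρ_{M'}(T ∪ {x}) − 1`, complement rank `p = ρ_{M'}(G'' ∖ T ∪ {x}) − 1`),
  and the level side is `#{T ⊆ G'' : ρ_N(T) = q + 1} = #{S ∋ x : ρ_{M'}(S) = q + 2}`.  So the row `(q+1, q+2)` of `M` follows from the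
  row `(q+1, q+2)` of `M ＼ {y}` and the row `(q, q+1)` of `(M ／ {x}) ＼ {y}`.
* **`profileIneq_thin_all`**: for every `q ≥ 2` and every finite matroid in which every rank-`q` set has at most `q + 1` points, the row
  `(q, q+1)` of (Π) — no simplicity hypothesis: a thin(q) matroid has at most one defect (`C025ProfileThinNonSimple`), a loop doubles
  (part A) into g16's `profileIneq_thin_simple_all'` on the simple thin `M ＼ {ℓ}`, a parallel pair is the profile Theorem F on the
  simple thin(q) `M ＼ {y}` and the simple thin(q − 1) `(M ／ {x}) ＼ {y}`; `profileIneq_thin_all_indep` states thinness in `M.Indep` /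
  `encard` terms; `rls_succ_succ_thin_of_row` re-derives C-025 at `(q + 2, q)` through the row.
No `def`, no `instance`, no notation.  Axioms: standard.
-/
open scoped Matroid
namespace PercRepro
open Set Finset ThmH Staged
namespace ThinGirth
variable {α : Type} [DecidableEq α] {M : Matroid α} [M.Finite]

/-- **A parallel pair is a profile Theorem F**: for non-loops `x ≠ y` with `y ∈ cl{x}`, the row `(q+1, q+2)` of `M` follows from the
row `(q+1, q+2)` of `M ＼ {y}` and the row `(q, q+1)` of `(M ／ {x}) ＼ {y}`. -/
theorem profileIneq_of_parallel {x y : α} (hx : M.Indep {x}) (hy : M.Indep {y}) (hxy : x ≠ y)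
    (hpar : y ∈ M.closure {x}) (q : ℕ)
    (h1 : Profile.ProfileIneq (M ＼ {y}) (q + 1) (q + 1 + 1))
    (h2 : Profile.ProfileIneq ((M ／ {x}) ＼ {y}) q (q + 1)) :
    Profile.ProfileIneq M (q + 1) (q + 1 + 1) := by
  have hxE : x ∈ M.E := hx.subset_ground (mem_singleton x)
  have hyE : y ∈ M.E := hy.subset_ground (mem_singleton y)
  -- `x ∈ cl{y}` from `y ∈ cl{x}` and `y` a non-loop
  have hpar' : x ∈ M.closure {y} := by
    by_contra hnx
    have hdep : ¬ M.Indep (insert y {x}) := by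
      rw [hx.insert_indep_iff_of_notMem (by simpa using hxy.symm)]
      exact fun h => h.2 hpar
    apply hdep
    rw [Set.pair_comm, hy.insert_indep_iff_of_notMem (by simpa using hxy)]
    exact ⟨hxE, hnx⟩
  have hxg : x ∈ gr M := mem_gr_of_mem_ground hxE
  have hyg : y ∈ gr M := mem_gr_of_mem_ground hyE
  -- the three ground sets
  have hG'' : gr ((M ／ {x}) ＼ {y}) = ((gr M).erase x).erase y := by rw [gr_delete, gr_contract]
  set G'' := ((gr M).erase x).erase y with hG''def
  have hxG'' : x ∉ G'' := by
    rw [hG''def, Finset.erase_right_comm]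
    exact Finset.notMem_erase x _
  have hyG'' : y ∉ G'' := Finset.notMem_erase y _
  have hG' : gr (M ＼ {y}) = insert x G'' := by
    rw [gr_delete, hG''def, Finset.erase_right_comm, Finset.insert_erase (Finset.mem_erase.2 ⟨hxy, hxg⟩)]
  have hG : gr M = insert y (insert x G'') := by
    rw [hG''def, Finset.erase_right_comm, Finset.insert_erase (Finset.mem_erase.2 ⟨hxy, hxg⟩),
      Finset.insert_erase hyg]
  -- facts about `T ⊆ G''`
  have hTE : ∀ T ⊆ G'', (T : Set α) ⊆ M.E := by
    intro T hT
    have : T ⊆ gr M := hT.trans ((Finset.erase_subset _ _).trans (Finset.erase_subset _ _))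
    rw [← coe_gr]
    exact_mod_cast this
  have hxT : ∀ T ⊆ G'', x ∉ T := fun T hT h => hxG'' (hT h)
  have hyT : ∀ T ⊆ G'', y ∉ T := fun T hT h => hyG'' (hT h)
  have hxTE : ∀ T ⊆ G'', ((insert x T : Finset α) : Set α) ⊆ M.E := by
    intro T hT
    rw [Finset.coe_insert]
    exact insert_subset hxE (hTE T hT)
  have hyTE : ∀ T ⊆ G'', ((insert y T : Finset α) : Set α) ⊆ M.E := by
    intro T hT
    rw [Finset.coe_insert]
    exact insert_subset hyE (hTE T hT)
  -- ranks
  have ra : ∀ T ⊆ G'', M.eRk (T : Set α) = (M ＼ {y}).eRk (T : Set α) := fun T hT =>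
    (delete_singleton_eRk_eq (coe_subset_diff_singleton (hTE T hT) (hyT T hT))).symm
  have rb : ∀ T ⊆ G'', M.eRk ((insert x T : Finset α) : Set α) = (M ＼ {y}).eRk ((insert x T : Finset α) : Set α) := by
    intro T hT
    refine (delete_singleton_eRk_eq (coe_subset_diff_singleton (hxTE T hT) ?_)).symm
    rw [Finset.mem_insert]
    rintro (h | h)
    · exact hxy h.symm
    · exact hyT T hT h
  have rd : ∀ T ⊆ G'', M.eRk ((insert y (insert x T) : Finset α) : Set α) = M.eRk ((insert x T : Finset α) : Set α) := by
    intro T hT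
    rw [Finset.coe_insert y, eRk_insert_eq_of_mem_closure (hxTE T hT)]
    refine M.closure_subset_closure ?_ hpar
    rw [Finset.coe_insert]
    exact singleton_subset_iff.2 (mem_insert x _)
  have rc : ∀ T ⊆ G'', M.eRk ((insert y T : Finset α) : Set α) = M.eRk ((insert x T : Finset α) : Set α) := by
    intro T hT
    have h1 : M.eRk ((insert x (insert y T) : Finset α) : Set α) = M.eRk ((insert y T : Finset α) : Set α) := by
      rw [Finset.coe_insert x, eRk_insert_eq_of_mem_closure (hyTE T hT)]
      refine M.closure_subset_closure ?_ hpar'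
      rw [Finset.coe_insert]
      exact singleton_subset_iff.2 (mem_insert y _)
    rw [← h1, Finset.insert_comm, rd T hT]
  have re : ∀ T ⊆ G'', (M ＼ {y}).eRk ((insert x T : Finset α) : Set α) = ((M ／ {x}) ＼ {y}).eRk (T : Set α) + 1 := by
    intro T hT
    have hTx : (T : Set α) ⊆ M.E \ {x} := coe_subset_diff_singleton (hTE T hT) (hxT T hT)
    have hTxy : (T : Set α) ⊆ (M ／ {x}).E \ {y} := by
      rw [Matroid.contract_ground]
      exact fun z hz => ⟨hTx hz, fun h => hyT T hT (mem_singleton_iff.1 h ▸ Finset.mem_coe.1 hz)⟩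
    rw [delete_singleton_eRk_eq hTxy, contract_singleton_eRk_add_one hx hTx, ← Finset.coe_insert, rb T hT]
  -- complements
  have c0 : ∀ T ⊆ G'', gr M \ T = insert y (insert x (G'' \ T)) := by
    intro T hT
    rw [hG, Finset.insert_sdiff_of_notMem _ (hyT T hT), Finset.insert_sdiff_of_notMem _ (hxT T hT)]
  have hyxT : ∀ T ⊆ G'', y ∉ insert x T := by
    intro T hT h
    rw [Finset.mem_insert] at h
    rcases h with h | h
    · exact hxy h.symm
    · exact hyT T hT h
  have hxyT : ∀ T ⊆ G'', x ∉ insert y T := by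
    intro T hT h
    rw [Finset.mem_insert] at h
    rcases h with h | h
    · exact hxy h
    · exact hxT T hT h
  have hxGT : ∀ T ⊆ G'', x ∉ G'' \ T := fun T _ h => hxG'' (Finset.mem_sdiff.1 h).1
  have hyGT : ∀ T ⊆ G'', y ∉ G'' \ T := fun T _ h => hyG'' (Finset.mem_sdiff.1 h).1
  have cx : ∀ T ⊆ G'', gr M \ insert x T = insert y (G'' \ T) := by
    intro T hT
    rw [hG, Finset.insert_sdiff_of_notMem _ (hyxT T hT), Finset.insert_sdiff_insert, Finset.sdiff_insert,
      Finset.erase_eq_of_notMem (hxGT T hT)]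
  have cy : ∀ T ⊆ G'', gr M \ insert y T = insert x (G'' \ T) := by
    intro T hT
    rw [hG, Finset.insert_sdiff_insert, Finset.insert_sdiff_of_notMem _ (hxyT T hT), Finset.sdiff_insert,
      Finset.erase_eq_of_notMem (hyGT T hT)]
  have cxy : ∀ T ⊆ G'', gr M \ insert y (insert x T) = G'' \ T := by
    intro T hT
    rw [hG, Finset.insert_sdiff_insert, Finset.insert_comm y x T, Finset.insert_sdiff_insert, Finset.sdiff_insert,
      Finset.sdiff_insert, Finset.erase_eq_of_notMem (hyGT T hT), Finset.erase_eq_of_notMem (hxGT T hT)]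
  have c0' : ∀ T ⊆ G'', gr (M ＼ {y}) \ T = insert x (G'' \ T) := by
    intro T hT
    rw [hG', Finset.insert_sdiff_of_notMem _ (hxT T hT)]
  have cx' : ∀ T ⊆ G'', gr (M ＼ {y}) \ insert x T = G'' \ T := by
    intro T hT
    rw [hG', Finset.insert_sdiff_insert, Finset.sdiff_insert, Finset.erase_eq_of_notMem (hxGT T hT)]
  have cN : ∀ T ⊆ G'', gr ((M ／ {x}) ＼ {y}) \ T = G'' \ T := by
    intro T _
    rw [hG'']
  have hGT : ∀ T ⊆ G'', G'' \ T ⊆ G'' := fun T _ => Finset.sdiff_subset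
  -- the row, unfolded on both sides
  unfold Profile.ProfileIneq at h1 h2 ⊢
  rw [sum_Rq_eq_sum_powerset, card_levelSet_eq_sum] at h1 h2 ⊢
  rw [hG, sum_powerset_insert_insert hxy hxG'' hyG'', sum_powerset_insert_insert hxy hxG'' hyG'']
  rw [hG', Finset.sum_powerset_insert hxG'', Finset.sum_powerset_insert hxG''] at h1
  rw [hG''] at h2
  -- the left side of `M`: the left side of `M ＼ {y}` plus twice the rooted terms
  have hL : ∀ T ∈ G''.powerset,
      ((if M.eRk (T : Set α) = ((q + 1 : ℕ) : ℕ∞) then Profile.price M (q + 1) (q + 1 + 1) T else 0) +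
        (if M.eRk ((insert x T : Finset α) : Set α) = ((q + 1 : ℕ) : ℕ∞) then
          Profile.price M (q + 1) (q + 1 + 1) (insert x T) else 0) +
        (if M.eRk ((insert y T : Finset α) : Set α) = ((q + 1 : ℕ) : ℕ∞) then
          Profile.price M (q + 1) (q + 1 + 1) (insert y T) else 0) +
        (if M.eRk ((insert y (insert x T) : Finset α) : Set α) = ((q + 1 : ℕ) : ℕ∞) then
          Profile.price M (q + 1) (q + 1 + 1) (insert y (insert x T)) else 0)) =
      ((if (M ＼ {y}).eRk (T : Set α) = ((q + 1 : ℕ) : ℕ∞) then Profile.price (M ＼ {y}) (q + 1) (q + 1 + 1) T else 0) +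
        (if (M ＼ {y}).eRk ((insert x T : Finset α) : Set α) = ((q + 1 : ℕ) : ℕ∞) then
          Profile.price (M ＼ {y}) (q + 1) (q + 1 + 1) (insert x T) else 0)) +
      2 * (if ((M ／ {x}) ＼ {y}).eRk (T : Set α) = (q : ℕ∞) then
          Profile.price M (q + 1) (q + 1 + 1) (insert x T) else 0) := by
    intro T hT
    rw [Finset.mem_powerset] at hT
    have t1 : (if M.eRk (T : Set α) = ((q + 1 : ℕ) : ℕ∞) then Profile.price M (q + 1) (q + 1 + 1) T else 0) =
        (if (M ＼ {y}).eRk (T : Set α) = ((q + 1 : ℕ) : ℕ∞) then Profile.price (M ＼ {y}) (q + 1) (q + 1 + 1) T else 0) := by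
      refine ite_congr_of_iff (by rw [ra T hT]) (fun _ => ?_)
      apply price_eq_of_eRk_eq
      rw [c0 T hT, c0' T hT, rd _ (hGT T hT), rb _ (hGT T hT)]
    have t4 : (if M.eRk ((insert y (insert x T) : Finset α) : Set α) = ((q + 1 : ℕ) : ℕ∞) then
          Profile.price M (q + 1) (q + 1 + 1) (insert y (insert x T)) else 0) =
        (if (M ＼ {y}).eRk ((insert x T : Finset α) : Set α) = ((q + 1 : ℕ) : ℕ∞) then
          Profile.price (M ＼ {y}) (q + 1) (q + 1 + 1) (insert x T) else 0) := by
      refine ite_congr_of_iff (by rw [rd T hT, rb T hT]) (fun _ => ?_)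
      apply price_eq_of_eRk_eq
      rw [cxy T hT, cx' T hT, ra _ (hGT T hT)]
    have t2 : (if M.eRk ((insert x T : Finset α) : Set α) = ((q + 1 : ℕ) : ℕ∞) then
          Profile.price M (q + 1) (q + 1 + 1) (insert x T) else 0) =
        (if ((M ／ {x}) ＼ {y}).eRk (T : Set α) = (q : ℕ∞) then Profile.price M (q + 1) (q + 1 + 1) (insert x T) else 0) := by
      refine ite_congr_of_iff ?_ (fun _ => rfl)
      rw [rb T hT, re T hT, eRk_add_one_eq_iff]
    have t3 : (if M.eRk ((insert y T : Finset α) : Set α) = ((q + 1 : ℕ) : ℕ∞) then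
          Profile.price M (q + 1) (q + 1 + 1) (insert y T) else 0) =
        (if ((M ／ {x}) ＼ {y}).eRk (T : Set α) = (q : ℕ∞) then Profile.price M (q + 1) (q + 1 + 1) (insert x T) else 0) := by
      refine ite_congr_of_iff ?_ (fun _ => ?_)
      · rw [rc T hT, rb T hT, re T hT, eRk_add_one_eq_iff]
      · apply price_eq_of_eRk_eq
        rw [cy T hT, cx T hT, rc _ (hGT T hT)]
    rw [t1, t2, t3, t4]
    ring
  -- the right side of `M`: the right side of `M ＼ {y}` plus twice the rank-`(q+1)` sets of `N`
  have hR : ∀ T ∈ G''.powerset,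
      ((if M.eRk (T : Set α) = ((q + 1 + 1 : ℕ) : ℕ∞) then (1 : ℚ) else 0) +
        (if M.eRk ((insert x T : Finset α) : Set α) = ((q + 1 + 1 : ℕ) : ℕ∞) then (1 : ℚ) else 0) +
        (if M.eRk ((insert y T : Finset α) : Set α) = ((q + 1 + 1 : ℕ) : ℕ∞) then (1 : ℚ) else 0) +
        (if M.eRk ((insert y (insert x T) : Finset α) : Set α) = ((q + 1 + 1 : ℕ) : ℕ∞) then (1 : ℚ) else 0)) =
      ((if (M ＼ {y}).eRk (T : Set α) = ((q + 1 + 1 : ℕ) : ℕ∞) then (1 : ℚ) else 0) +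
        (if (M ＼ {y}).eRk ((insert x T : Finset α) : Set α) = ((q + 1 + 1 : ℕ) : ℕ∞) then (1 : ℚ) else 0)) +
      2 * (if ((M ／ {x}) ＼ {y}).eRk (T : Set α) = ((q + 1 : ℕ) : ℕ∞) then (1 : ℚ) else 0) := by
    intro T hT
    rw [Finset.mem_powerset] at hT
    have t1 : (if M.eRk (T : Set α) = ((q + 1 + 1 : ℕ) : ℕ∞) then (1 : ℚ) else 0) =
        (if (M ＼ {y}).eRk (T : Set α) = ((q + 1 + 1 : ℕ) : ℕ∞) then (1 : ℚ) else 0) := by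
      rw [ra T hT]
    have t4 : (if M.eRk ((insert y (insert x T) : Finset α) : Set α) = ((q + 1 + 1 : ℕ) : ℕ∞) then (1 : ℚ) else 0) =
        (if (M ＼ {y}).eRk ((insert x T : Finset α) : Set α) = ((q + 1 + 1 : ℕ) : ℕ∞) then (1 : ℚ) else 0) := by
      rw [rd T hT, rb T hT]
    have t2 : (if M.eRk ((insert x T : Finset α) : Set α) = ((q + 1 + 1 : ℕ) : ℕ∞) then (1 : ℚ) else 0) =
        (if ((M ／ {x}) ＼ {y}).eRk (T : Set α) = ((q + 1 : ℕ) : ℕ∞) then (1 : ℚ) else 0) := by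
      refine ite_congr_of_iff ?_ (fun _ => rfl)
      rw [rb T hT, re T hT, eRk_add_one_eq_iff]
    have t3 : (if M.eRk ((insert y T : Finset α) : Set α) = ((q + 1 + 1 : ℕ) : ℕ∞) then (1 : ℚ) else 0) =
        (if ((M ／ {x}) ＼ {y}).eRk (T : Set α) = ((q + 1 : ℕ) : ℕ∞) then (1 : ℚ) else 0) := by
      refine ite_congr_of_iff ?_ (fun _ => rfl)
      rw [rc T hT, rb T hT, re T hT, eRk_add_one_eq_iff]
    rw [t1, t2, t3, t4]
    ring
  -- the rooted terms are at most the terms of the row `(q, q+1)` of `N`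
  have hrooted : ∀ T ∈ G''.powerset,
      (if ((M ／ {x}) ＼ {y}).eRk (T : Set α) = (q : ℕ∞) then Profile.price M (q + 1) (q + 1 + 1) (insert x T) else 0) ≤
        (if ((M ／ {x}) ＼ {y}).eRk (T : Set α) = (q : ℕ∞) then Profile.price ((M ／ {x}) ＼ {y}) q (q + 1) T else 0) := by
    intro T hT
    rw [Finset.mem_powerset] at hT
    refine ite_le_of_iff Iff.rfl (fun _ => ?_)
    apply price_rooted_le
    rw [cx T hT, cN T hT, rc _ (hGT T hT), rb _ (hGT T hT), re _ (hGT T hT)]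
  rw [Finset.sum_congr rfl hL, Finset.sum_congr rfl hR, Finset.sum_add_distrib, Finset.sum_add_distrib,
    Finset.sum_add_distrib, Finset.sum_add_distrib, ← Finset.mul_sum, ← Finset.mul_sum]
  have := Finset.sum_le_sum hrooted
  linarith

/-! ### The row on every thin(q) matroid -/

/-- The row is trivial when `ρ(E) < q` (no rank-`q` set). -/
theorem profileIneq_of_rkN_lt {q u : ℕ} (h : rkN M (gr M) < q) : Profile.ProfileIneq M q u := by
  unfold Profile.ProfileIneq
  have hempty : Profile.Rq M q = ∅ := by
    rw [Finset.eq_empty_iff_forall_notMem]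
    intro B hB
    rw [Profile.mem_Rq] at hB
    have h1 : rkN M B ≤ rkN M (gr M) := rkN_mono hB.1
    have h2 : rkN M B = q := by rw [rkN_eq_iff]; exact hB.2
    omega
  rw [hempty, Finset.sum_empty]
  exact Nat.cast_nonneg _

/-- **THE ROW `(q, q+1)` OF (Π) ON EVERY THIN(q) MATROID, `q ≥ 2`**: every finite matroid in which every rank-`q` set has at most
`q + 1` points — simple or not — satisfies the profile inequality `Profile.ProfileIneq M q (q + 1)` (the statement of C-032 at
`(q, q+1)`).  A loop doubles into g16's `profileIneq_thin_simple_all'` on `M ＼ {ℓ}`; a parallel pair `x ∥ y` is the profile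
Theorem F on `M ＼ {y}` (simple, thin(q)) at `(q, q+1)` and on `(M ／ {x}) ＼ {y}` (simple, thin(q − 1)) at `(q − 1, q)`. -/
theorem profileIneq_thin_all (q : ℕ) (hq : 2 ≤ q)
    (hthin : ∀ X ⊆ gr M, rkN M X = q → X.card ≤ q + 1) : Profile.ProfileIneq M q (q + 1) := by
  rcases Nat.lt_or_ge (rkN M (gr M)) q with hlt | hE
  · exact profileIneq_of_rkN_lt hlt
  by_cases hloop : ∃ e, M.IsLoop e
  · obtain ⟨e, he⟩ := hloop
    exact profileIneq_of_isLoop he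
      (profileIneq_thin_simple_all' q (simple_delete_of_isLoop hq hthin hE he) (thin_delete hthin e))
  have hnl : ∀ x ∈ M.E, M.Indep {x} := by
    intro x hx
    exact Matroid.indep_singleton.2 ((Matroid.not_isLoop_iff hx).1 (fun h => hloop ⟨x, h⟩))
  by_cases hsimple : ∀ T ⊆ M.E, T.encard ≤ 2 → M.Indep T
  · exact profileIneq_thin_simple_all' q hsimple hthin
  obtain ⟨e, e', heE, he'E, hne, _, hpar'⟩ := exists_parallel_of_not_simple hnl hsimple
  obtain ⟨q', rfl⟩ : ∃ q', q = q' + 1 := ⟨q - 1, by omega⟩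
  refine profileIneq_of_parallel (hnl e heE) (hnl e' he'E) hne.symm hpar' q' ?_ ?_
  · exact profileIneq_thin_simple_all' (q' + 1) (simple_delete_of_parallel hq hthin hE heE hne.symm hpar')
      (thin_delete hthin e')
  · exact profileIneq_thin_simple_all' q'
      (simple_contract_delete_of_parallel hq hthin hE (hnl e heE) he'E hne hpar') (thin_contract_delete hthin (hnl e heE))

/-- The row `(q, q+1)` on every thin(q) matroid, thinness in `M.Indep` / `encard` terms (no set of `q + 2` points has rank `≤ q`). -/
theorem profileIneq_thin_all_indep (q : ℕ) (hq : 2 ≤ q)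
    (hthin : ∀ T ⊆ M.E, T.encard = (q + 2 : ℕ) → (q + 1 : ℕ∞) ≤ M.eRk T) : Profile.ProfileIneq M q (q + 1) := by
  apply profileIneq_thin_all q hq
  intro X hXg hXr
  by_contra hc
  push Not at hc
  obtain ⟨Y, hYX, hYc⟩ := Finset.exists_subset_card_eq (show q + 2 ≤ X.card by omega)
  have hYE : (Y : Set α) ⊆ M.E := by
    rw [← coe_gr]
    exact_mod_cast hYX.trans hXg
  have h1 := hthin Y hYE (by rw [Set.encard_coe_eq_coe_finsetCard, hYc])
  have h2 : rkN M Y ≤ rkN M X := rkN_mono hYX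
  rw [← coe_rkN] at h1
  have h3 : q + 1 ≤ rkN M Y := by exact_mod_cast h1
  omega

/-- C-025 at `(q + 2, q)` on every thin(q) matroid, `q ≥ 2`, THROUGH THE ROW (a second proof of
`C025ProfileThinNonSimple.rls_succ_succ_thin`, by the bridge `rls_succ_succ_of_profileIneq`). -/
theorem rls_succ_succ_thin_of_row (q : ℕ) (hq : 2 ≤ q)
    (hthin : ∀ X ⊆ gr M, rkN M X = q → X.card ≤ q + 1) : ThmN.RLS M (q + 2) q :=
  rls_succ_succ_of_profileIneq q (profileIneq_thin_all q hq hthin)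

end ThinGirth
end PercRepro
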